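import Literature.Analysis.DeBrangesSpaces.BurnolSonineDistributionsProofs
import Literature.Analysis.Fourier.FourierCompactSupportAnalytic
import Literature.Analysis.FunctionSpaces.PlancherelL1L2
import HarnessLib

/-!
# Burnol, *Sur les « espaces de Sonine » associés par de Branges à la transformation de Fourier*
(C. R. Acad. Sci. Paris 335 (2002) 689–692) — Théorème 7, with proof

The note STATES Théorème 7 (TeX l.369–375) without proof.  This file discharges the named fact
`Burnol2002CRAS_thm7` of `BurnolSonineStructureFunction.lean`:

* `ψ_±^λ(t) = 2cos(2πλt) ∓ ∫_{[−λ,λ]} h_±(y) e^{2πity} dy` is the Fourier–Laplace transform of the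
  compactly supported `L²` class `h_± = (1 ± F_λ)^{-1}P_λ(2cos 2πλy)`, hence ENTIRE
  (`Literature.Analysis.Fourier.differentiable_fourierLaplace`), and EVEN because `h_±` is
  (`compNeg_hPlus`);
* on the real line `∫_{[−λ,λ]} h_±(y)e^{2πixy}dy` is (the continuous representative of) `𝓕h_±`, so
  `h_± ± 𝓕h_± = 2cos(2πλ·)` a.e. on `[−λ,λ]` (`hPlus_add_fourier_eq_ae`) reads `ψ_± = h_±` a.e. on
  `(−λ,λ)`; an entire function is determined by its a.e. values on an interval (identity theorem);
* the integral equation `φ(x) ± ∫_{[−λ,λ]} φ(y)e^{2πixy}dy = 2cos(2πλx)` then holds for `ψ_±`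
  tautologically, and a second solution `φ`, integrable on `[−λ,λ]`, differs from `ψ_±` by a `δ` with
  `δ = ∓ ∫_{[−λ,λ]} δ e^{2πix·}` — bounded, so `u = 𝟙_{[−λ,λ]}·conj δ ∈ L²` satisfies `(1 ± F_λ)u = 0`,
  whence `u = 0` (`‖F_λ‖ < 1`, `isUnit_one_add_slepianF`) and `δ ≡ 0`;
* the identities `A_λ = ψ_+ + 𝓕ψ_+`, `−iB_λ = −ψ_− + 𝓕ψ_−` in `𝓢'` follow from Définition 1 by the
  multiplication formula and Fourier inversion on `𝓢` (as in `fourier_distA`).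

RH-FREE throughout.

## References
* [Burnol2002CRAS] J.-F. Burnol, C. R. Acad. Sci. Paris, Ser. I 335 (2002) 689–692, §4,
  Définitions 1–2 (TeX l.346–367), Théorème 7 (TeX l.369–375).
* [Grafakos2014] L. Grafakos, *Classical Fourier Analysis*, 3rd ed., GTM 249 (2014), Def. 2.2.8
  (PDF p. 125), Thm. 2.2.14 (1)–(2) (PDF p. 128).
-/

open MeasureTheory Set Filter Complex FourierTransform
open scoped Real Topology ENNReal FourierTransform ComplexConjugate SchwartzMap

open Literature.NumberTheory.ConnesConsani2021 (cutoffProj cutoffProjHat compNeg_cutoffProj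
  cutoffProj_coeFn cutoffProj_idem)
open Literature.Analysis.Fourier (coeFn_compNeg compNeg_compNeg fourier_compNeg
  fourier_fourier_eq_compNeg integral_mul_fourier_eq integral_fourier_mul_eq
  differentiable_fourierLaplace fourier_eq_fourierLaplace)
open Literature.Analysis.FunctionSpaces (fourier_toLp_ae_eq_fourierIntegral)

namespace Literature.Analysis.DeBrangesSpaces

namespace Burnol2002

/-! ## A. The Fourier–Laplace integral `t ↦ ∫_{[−λ,λ]} h(y) e^{2πity} dy` of a class `h = P_λ h` -/

/-- `𝟙_{[−λ,λ]}·h` is integrable for `h ∈ L²(ℝ)`. [folklore] -/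
private theorem integrable_indicator_Icc' (lam : ℝ) (h : Lp ℂ 2 (volume : Measure ℝ)) :
    Integrable ((Icc (-lam) lam).indicator (h : ℝ → ℂ)) := by
  rw [integrable_indicator_iff measurableSet_Icc, IntegrableOn, ← memLp_one_iff_integrable]
  exact ((Lp.memLp h).restrict (Icc (-lam) lam)).mono_exponent one_le_two

/-- `𝟙_{[−λ,λ]}·h ∈ L²`. [folklore] -/
private theorem memLp_indicator_Icc' (lam : ℝ) (h : Lp ℂ 2 (volume : Measure ℝ)) :
    MemLp ((Icc (-lam) lam).indicator (h : ℝ → ℂ)) 2 (volume : Measure ℝ) :=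
  (Lp.memLp h).indicator measurableSet_Icc

/-- If `P_λ h = h` then `h` is the class of `𝟙_{[−λ,λ]}·h`. [folklore] -/
private theorem toLp_indicator_eq {lam : ℝ} {h : Lp ℂ 2 (volume : Measure ℝ)}
    (hP : cutoffProj lam h = h) :
    (memLp_indicator_Icc' lam h).toLp _ = h := by
  refine Lp.ext ?_
  have h1 : (h : ℝ → ℂ) =ᵐ[volume] (cutoffProj lam h : Lp ℂ 2 (volume : Measure ℝ)) := by rw [hP]
  filter_upwards [(memLp_indicator_Icc' lam h).coeFn_toLp, h1, cutoffProj_coeFn lam h]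
    with x e1 e2 e3
  rw [e1, e2, e3]

/-- The set integral as a Fourier–Laplace integral over `ℝ`:
`∫_{[−λ,λ]} h(y)e^{2πity}dy = ∫ e^{−2πiy(−t)} (𝟙_{[−λ,λ]}h)(y) dy`. [folklore] -/
private theorem setIntegral_eq_fourierLaplace (lam : ℝ) (h : Lp ℂ 2 (volume : Measure ℝ)) (t : ℂ) :
    ∫ y in Icc (-lam) lam, h y * cexp (2 * π * I * t * y) =
      ∫ v : ℝ, cexp (((-(2 * π * v) : ℝ) : ℂ) * (-t) * I) * (Icc (-lam) lam).indicator (h : ℝ → ℂ) v := by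
  rw [← integral_indicator measurableSet_Icc]
  refine integral_congr_ae (Eventually.of_forall fun v ↦ ?_)
  by_cases hv : v ∈ Icc (-lam) lam
  · simp only [Set.indicator_of_mem hv, mul_comm ((h : ℝ → ℂ) v)]
    congr 1
    congr 1
    push_cast
    ring
  · simp only [Set.indicator_of_notMem hv, mul_zero]

/-- **`t ↦ ∫_{[−λ,λ]} h(y)e^{2πity}dy` is entire** (`λ ≥ 0`). [cite: Burnol2002CRAS, Théorème 7 (TeX l.369–375)] -/
theorem differentiable_setIntegral_mul_cexp {lam : ℝ} (hlam : 0 ≤ lam)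
    (h : Lp ℂ 2 (volume : Measure ℝ)) :
    Differentiable ℂ fun t : ℂ ↦ ∫ y in Icc (-lam) lam, h y * cexp (2 * π * I * t * y) := by
  have h0 : ∀ x, x ∉ Icc (-lam) lam → (Icc (-lam) lam).indicator (h : ℝ → ℂ) x = 0 :=
    fun x hx ↦ Set.indicator_of_notMem hx _
  have hd := (differentiable_fourierLaplace (integrable_indicator_Icc' lam h) hlam h0).comp
    differentiable_neg
  have he : (fun t : ℂ ↦ ∫ y in Icc (-lam) lam, h y * cexp (2 * π * I * t * y)) =
      (fun z : ℂ ↦ ∫ v : ℝ, cexp (((-(2 * π * v) : ℝ) : ℂ) * z * I) *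
        (Icc (-lam) lam).indicator (h : ℝ → ℂ) v) ∘ fun t : ℂ ↦ -t := by
    funext t
    simp only [Function.comp_apply, setIntegral_eq_fourierLaplace]
  rw [he]
  exact hd

/-- For an EVEN class `h` (`R h = h`): `𝟙_{[−λ,λ]}h` is a.e. even. [folklore] -/
private theorem indicator_neg_ae_eq {lam : ℝ} {h : Lp ℂ 2 (volume : Measure ℝ)}
    (hR : Lp.compMeasurePreserving (fun x : ℝ ↦ -x) (Measure.measurePreserving_neg (volume : Measure ℝ))
      h = h) :
    ∀ᵐ v : ℝ, (Icc (-lam) lam).indicator (h : ℝ → ℂ) (-v) = (Icc (-lam) lam).indicator (h : ℝ → ℂ) v := by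
  have h1 := coeFn_compNeg (F := ℂ) h
  rw [hR] at h1
  filter_upwards [h1] with v hv
  by_cases hvI : v ∈ Icc (-lam) lam
  · have hvI' : -v ∈ Icc (-lam) lam := by
      rw [mem_Icc] at hvI ⊢; constructor <;> linarith [hvI.1, hvI.2]
    rw [Set.indicator_of_mem hvI, Set.indicator_of_mem hvI', ← hv]
  · have hvI' : -v ∉ Icc (-lam) lam := by
      intro h'; apply hvI; rw [mem_Icc] at h' ⊢; constructor <;> linarith [h'.1, h'.2]
    rw [Set.indicator_of_notMem hvI, Set.indicator_of_notMem hvI']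

/-- **Evenness**: for an even class `h`, `∫_{[−λ,λ]} h(y)e^{2πi(−t)y}dy = ∫_{[−λ,λ]} h(y)e^{2πity}dy`.
[cite: Burnol2002CRAS, Théorème 7 (TeX l.369–375)] -/
theorem setIntegral_mul_cexp_neg {lam : ℝ} {h : Lp ℂ 2 (volume : Measure ℝ)}
    (hR : Lp.compMeasurePreserving (fun x : ℝ ↦ -x) (Measure.measurePreserving_neg (volume : Measure ℝ))
      h = h) (t : ℂ) :
    ∫ y in Icc (-lam) lam, h y * cexp (2 * π * I * (-t) * y) =
      ∫ y in Icc (-lam) lam, h y * cexp (2 * π * I * t * y) := by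
  rw [setIntegral_eq_fourierLaplace, setIntegral_eq_fourierLaplace, neg_neg]
  -- substitute `v ↦ −v` on the right-hand side
  have hsub := ((Measure.measurePreserving_neg (volume : Measure ℝ)).integral_comp
    (Homeomorph.neg ℝ).measurableEmbedding
    (fun v : ℝ ↦ cexp (((-(2 * π * v) : ℝ) : ℂ) * (-t) * I) *
      (Icc (-lam) lam).indicator (h : ℝ → ℂ) v))
  rw [← hsub]
  refine integral_congr_ae ?_
  filter_upwards [indicator_neg_ae_eq (lam := lam) hR] with v hv
  rw [hv]
  congr 1
  congr 1
  push_cast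
  ring

/-- **On the real line, `∫_{[−λ,λ]} h(y)e^{2πixy}dy` represents `𝓕h`** for an even class `h = P_λ h`:
`(𝓕h)(x) = ∫_{[−λ,λ]} h(y)e^{2πixy}dy` for a.e. `x`. [cite: Burnol2002CRAS, Définition 2 (TeX l.361–367)] -/
theorem fourier_coeFn_ae_eq_setIntegral {lam : ℝ} {h : Lp ℂ 2 (volume : Measure ℝ)}
    (hP : cutoffProj lam h = h)
    (hR : Lp.compMeasurePreserving (fun x : ℝ ↦ -x) (Measure.measurePreserving_neg (volume : Measure ℝ))
      h = h) :
    ∀ᵐ x : ℝ, (𝓕 h : Lp ℂ 2 (volume : Measure ℝ)) x =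
      ∫ y in Icc (-lam) lam, h y * cexp (2 * π * I * (x : ℂ) * y) := by
  have h1 := fourier_toLp_ae_eq_fourierIntegral (integrable_indicator_Icc' lam h)
    (memLp_indicator_Icc' lam h)
  rw [toLp_indicator_eq hP] at h1
  filter_upwards [h1] with x hx
  rw [hx, fourier_eq_fourierLaplace, ← setIntegral_mul_cexp_neg hR, setIntegral_eq_fourierLaplace,
    neg_neg]

/-! ## B. `ψ_±` is entire and even; `ψ_± = h_±` a.e. on `(−λ,λ)`; uniqueness -/

/-- **`ψ_+^λ` is entire.** [cite: Burnol2002CRAS, Théorème 7 (TeX l.369–375)] -/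
theorem differentiable_psiPlus {lam : ℝ} (hlam : 0 ≤ lam) : Differentiable ℂ (psiPlus lam) := by
  unfold psiPlus
  exact ((((differentiable_id.const_mul _).ccos).const_mul _)).sub
    (differentiable_setIntegral_mul_cexp hlam (hPlus lam))

/-- **`ψ_−^λ` is entire.** [cite: Burnol2002CRAS, Théorème 7 (TeX l.369–375)] -/
theorem differentiable_psiMinus {lam : ℝ} (hlam : 0 ≤ lam) : Differentiable ℂ (psiMinus lam) := by
  unfold psiMinus
  exact ((((differentiable_id.const_mul _).ccos).const_mul _)).add
    (differentiable_setIntegral_mul_cexp hlam (hMinus lam))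

/-- **`ψ_+^λ` is even.** [cite: Burnol2002CRAS, Théorème 7 (TeX l.369–375)] -/
theorem psiPlus_neg (lam : ℝ) (t : ℂ) : psiPlus lam (-t) = psiPlus lam t := by
  unfold psiPlus
  rw [setIntegral_mul_cexp_neg (compNeg_hPlus lam), mul_neg, Complex.cos_neg]

/-- **`ψ_−^λ` is even.** [cite: Burnol2002CRAS, Théorème 7 (TeX l.369–375)] -/
theorem psiMinus_neg (lam : ℝ) (t : ℂ) : psiMinus lam (-t) = psiMinus lam t := by
  unfold psiMinus
  rw [setIntegral_mul_cexp_neg (compNeg_hMinus lam), mul_neg, Complex.cos_neg]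

/-- `2cos(2πλx)` (real `x`), complex form. [cite: Burnol2002CRAS, Définition 1 (TeX l.346–352)] -/
private theorem twoCos_eq (lam x : ℝ) :
    twoCos lam x = 2 * Complex.cos (2 * π * lam * (x : ℂ)) := by
  unfold twoCos
  rw [Complex.ofReal_cos]
  push_cast
  ring_nf

/-- **`ψ_+ = h_+` a.e. on `[−λ,λ]`** (from `h_+ + 𝓕h_+ = 2cos(2πλ·)` there and `𝓕h_+ = ∫ h_+ e^{2πix·}`).
[cite: Burnol2002CRAS, Théorème 7 (TeX l.369–375)] -/
theorem psiPlus_eq_hPlus_ae (lam : ℝ) :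
    ∀ᵐ x : ℝ, x ∈ Icc (-lam) lam → psiPlus lam x = hPlus lam x := by
  filter_upwards [hPlus_add_fourier_eq_ae lam,
    fourier_coeFn_ae_eq_setIntegral (cutoffProj_hPlus lam) (compNeg_hPlus lam)] with x h1 h2 hx
  have e := h1 hx
  rw [h2, twoCos_eq] at e
  unfold psiPlus
  rw [← e]
  ring

/-- **`ψ_− = h_−` a.e. on `[−λ,λ]`.** [cite: Burnol2002CRAS, Théorème 7 (TeX l.369–375)] -/
theorem psiMinus_eq_hMinus_ae (lam : ℝ) :
    ∀ᵐ x : ℝ, x ∈ Icc (-lam) lam → psiMinus lam x = hMinus lam x := by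
  filter_upwards [hMinus_sub_fourier_eq_ae lam,
    fourier_coeFn_ae_eq_setIntegral (cutoffProj_hMinus lam) (compNeg_hMinus lam)] with x h1 h2 hx
  have e := h1 hx
  rw [h2, twoCos_eq] at e
  unfold psiMinus
  rw [← e]
  ring

/-- Two functions continuous on an open set `U ⊆ ℝ` that agree a.e. on `U` agree on `U`. [folklore] -/
private theorem eqOn_of_ae_eq_of_isOpen {U : Set ℝ} (hU : IsOpen U) {f g : ℝ → ℂ}
    (hf : ContinuousOn f U) (hg : ContinuousOn g U) (h : ∀ᵐ t : ℝ, t ∈ U → f t = g t) :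
    EqOn f g U := by
  intro t₀ ht₀
  by_contra hne
  have hc : ContinuousWithinAt (fun t ↦ f t - g t) U t₀ := (hf t₀ ht₀).sub (hg t₀ ht₀)
  have hne' : f t₀ - g t₀ ≠ 0 := sub_ne_zero.2 hne
  have hmem : {t | f t - g t ≠ 0} ∈ 𝓝[U] t₀ := hc (isOpen_ne.mem_nhds hne')
  obtain ⟨V, hV, hVo, ht₀V⟩ :
      ∃ V : Set ℝ, V ⊆ {t | t ∈ U → f t - g t ≠ 0} ∧ IsOpen V ∧ t₀ ∈ V := by
    rcases mem_nhdsWithin.1 hmem with ⟨V, hVo, hV0, hV⟩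
    exact ⟨V, fun t ht htc ↦ hV ⟨ht, htc⟩, hVo, hV0⟩
  have hpos : 0 < volume (V ∩ U) := (hVo.inter hU).measure_pos volume ⟨t₀, ht₀V, ht₀⟩
  have hzero : volume (V ∩ U) = 0 := by
    have hsub : V ∩ U ⊆ {t | ¬(t ∈ U → f t = g t)} := by
      rintro t ⟨htV, htU⟩ himp
      exact hV htV htU (sub_eq_zero.2 (himp htU))
    exact measure_mono_null hsub (ae_iff.1 h)
  exact hpos.ne' hzero

/-- **Identity principle**: two entire functions that agree a.e. on the real interval `(−λ,λ)`
(`λ > 0`) are equal. [folklore] -/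
private theorem entire_eq_of_ae_eq_Ioo {lam : ℝ} (hlam : 0 < lam) {F G : ℂ → ℂ}
    (hF : Differentiable ℂ F) (hG : Differentiable ℂ G)
    (h : ∀ᵐ x : ℝ, x ∈ Ioo (-lam) lam → F x = G x) : F = G := by
  -- pointwise agreement on `(−λ,λ)`
  have hEq : EqOn (fun x : ℝ ↦ F x) (fun x : ℝ ↦ G x) (Ioo (-lam) lam) :=
    eqOn_of_ae_eq_of_isOpen isOpen_Ioo
      ((hF.continuous.comp Complex.continuous_ofReal).continuousOn)
      ((hG.continuous.comp Complex.continuous_ofReal).continuousOn) h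
  -- identity theorem on `ℂ`
  have hFa : AnalyticOnNhd ℂ F univ := hF.differentiableOn.analyticOnNhd isOpen_univ
  have hGa : AnalyticOnNhd ℂ G univ := hG.differentiableOn.analyticOnNhd isOpen_univ
  set u : ℕ → ℂ := fun n ↦ ((lam / ((n : ℝ) + 2) : ℝ) : ℂ) with hu
  have hu_mem : ∀ n : ℕ, lam / ((n : ℝ) + 2) ∈ Ioo (-lam) lam := by
    intro n
    have h2 : (2 : ℝ) ≤ (n : ℝ) + 2 := by linarith [n.cast_nonneg (α := ℝ)]
    have hpos : 0 < lam / ((n : ℝ) + 2) := by positivity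
    have hlt : lam / ((n : ℝ) + 2) < lam := by
      rw [div_lt_iff₀ (by positivity)]; nlinarith
    exact ⟨by linarith, hlt⟩
  have hu_lim : Tendsto u atTop (𝓝[≠] 0) := by
    refine tendsto_nhdsWithin_iff.2 ⟨?_, Eventually.of_forall fun n ↦ ?_⟩
    · have h1 : Tendsto (fun n : ℕ ↦ lam / ((n : ℝ) + 2)) atTop (𝓝 0) := by
        have ht : Tendsto (fun n : ℕ ↦ (n : ℝ) + 2) atTop atTop :=
          tendsto_natCast_atTop_atTop.atTop_add tendsto_const_nhds
        exact tendsto_const_nhds.div_atTop ht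
      have := (Complex.continuous_ofReal.tendsto 0).comp h1
      rwa [Complex.ofReal_zero] at this
    · rw [mem_compl_iff, mem_singleton_iff, hu, Complex.ofReal_eq_zero]
      have h2 : (0 : ℝ) < (n : ℝ) + 2 := by positivity
      exact (div_pos hlam h2).ne'
  have hfreq : ∃ᶠ z in 𝓝[≠] (0 : ℂ), F z = G z :=
    hu_lim.frequently (Frequently.of_forall fun n ↦ hEq (hu_mem n))
  have hFG : EqOn F G univ :=
    hFa.eqOn_of_preconnected_of_frequently_eq hGa isPreconnected_univ (mem_univ _) hfreq
  exact funext fun z ↦ hFG (mem_univ z)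

/-- **Uniqueness of `ψ_+`**: an entire function a.e. equal to `h_+` on `(−λ,λ)` is `ψ_+^λ`.
[cite: Burnol2002CRAS, Théorème 7 (TeX l.369–375)] -/
theorem eq_psiPlus_of_ae_eq {lam : ℝ} (hlam : 0 < lam) {G : ℂ → ℂ} (hG : Differentiable ℂ G)
    (h : ∀ᵐ x : ℝ, x ∈ Ioo (-lam) lam → G x = hPlus lam x) : G = psiPlus lam := by
  refine entire_eq_of_ae_eq_Ioo hlam hG (differentiable_psiPlus hlam.le) ?_
  filter_upwards [h, psiPlus_eq_hPlus_ae lam] with x h1 h2 hx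
  rw [h1 hx, h2 (Ioo_subset_Icc_self hx)]

/-- **Uniqueness of `ψ_−`.** [cite: Burnol2002CRAS, Théorème 7 (TeX l.369–375)] -/
theorem eq_psiMinus_of_ae_eq {lam : ℝ} (hlam : 0 < lam) {G : ℂ → ℂ} (hG : Differentiable ℂ G)
    (h : ∀ᵐ x : ℝ, x ∈ Ioo (-lam) lam → G x = hMinus lam x) : G = psiMinus lam := by
  refine entire_eq_of_ae_eq_Ioo hlam hG (differentiable_psiMinus hlam.le) ?_
  filter_upwards [h, psiMinus_eq_hMinus_ae lam] with x h1 h2 hx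
  rw [h1 hx, h2 (Ioo_subset_Icc_self hx)]

/-! ## C. The integral equations `φ(x) ± ∫_{[−λ,λ]} φ(y)e^{2πixy}dy = 2cos(2πλx)` -/

/-- **`ψ_+` solves `φ(x) + ∫_{[−λ,λ]} φ(y)e^{2πixy}dy = 2cos(2πλx)`** (real `x`).
[cite: Burnol2002CRAS, Théorème 7 (TeX l.369–375)] -/
theorem psiPlus_add_setIntegral (lam x : ℝ) :
    psiPlus lam x + ∫ y in Icc (-lam) lam, psiPlus lam y * cexp (2 * π * I * x * y) =
      2 * Complex.cos (2 * π * lam * x) := by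
  have h : ∫ y in Icc (-lam) lam, psiPlus lam y * cexp (2 * π * I * x * y) =
      ∫ y in Icc (-lam) lam, hPlus lam y * cexp (2 * π * I * x * y) := by
    refine setIntegral_congr_ae measurableSet_Icc ?_
    filter_upwards [psiPlus_eq_hPlus_ae lam] with y hy hyI
    rw [hy hyI]
  rw [h]
  unfold psiPlus
  ring

/-- **`ψ_−` solves `φ(x) − ∫_{[−λ,λ]} φ(y)e^{2πixy}dy = 2cos(2πλx)`** (real `x`).
[cite: Burnol2002CRAS, Théorème 7 (TeX l.369–375)] -/
theorem psiMinus_sub_setIntegral (lam x : ℝ) :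
    psiMinus lam x - ∫ y in Icc (-lam) lam, psiMinus lam y * cexp (2 * π * I * x * y) =
      2 * Complex.cos (2 * π * lam * x) := by
  have h : ∫ y in Icc (-lam) lam, psiMinus lam y * cexp (2 * π * I * x * y) =
      ∫ y in Icc (-lam) lam, hMinus lam y * cexp (2 * π * I * x * y) := by
    refine setIntegral_congr_ae measurableSet_Icc ?_
    filter_upwards [psiMinus_eq_hMinus_ae lam] with y hy hyI
    rw [hy hyI]
  rw [h]
  unfold psiMinus
  ring

/-- `‖e^{2πixy}‖ = 1` for real `x, y`. [folklore] -/
private theorem norm_cexp_two_pi_I (x y : ℝ) : ‖cexp (2 * π * I * x * y)‖ = 1 := by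
  rw [show (2 * π * I * x * y : ℂ) = ((2 * π * x * y : ℝ) : ℂ) * I by push_cast; ring,
    Complex.norm_exp_ofReal_mul_I]

/-- `conj (e^{2πixy}) = e^{−2πiyx}` in the Fourier–Laplace normal form. [folklore] -/
private theorem conj_cexp_two_pi_I (x y : ℝ) :
    conj (cexp (2 * π * I * x * y)) = cexp (((-(2 * π * y) : ℝ) : ℂ) * (x : ℂ) * I) := by
  rw [← Complex.exp_conj]
  congr 1
  simp only [map_mul, Complex.conj_ofReal, Complex.conj_I]
  push_cast
  simp only [map_ofNat]
  ring

/-- **Homogeneous uniqueness.** If `δ` is integrable on `[−λ,λ]` and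
`δ(x) = −ε ∫_{[−λ,λ]} δ(y)e^{2πixy}dy` for all real `x` with `ε = ±1`, then `δ ≡ 0`: `δ` is bounded,
`u = 𝟙_{[−λ,λ]}·conj δ ∈ L²` satisfies `P_λ 𝓕 u = −ε u`, so `(1 + εF_λ)u = 0`, and `1 ± F_λ` is
invertible (`‖F_λ‖ < 1`). [cite: Burnol2002CRAS, Théorème 7 (TeX l.369–375)] -/
theorem eq_zero_of_eq_neg_setIntegral {lam : ℝ} {δ : ℝ → ℂ} (hδ : IntegrableOn δ (Icc (-lam) lam))
    {ε : ℂ} (hε : ε = 1 ∨ ε = -1)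
    (h : ∀ x : ℝ, δ x = -ε * ∫ y in Icc (-lam) lam, δ y * cexp (2 * π * I * x * y)) :
    ∀ x : ℝ, δ x = 0 := by
  have hε2 : ε * ε = 1 := by rcases hε with rfl | rfl <;> norm_num
  have hεn : ‖ε‖ = 1 := by rcases hε with rfl | rfl <;> simp
  have hεc : conj ε = ε := by rcases hε with rfl | rfl <;> simp
  -- (1) `δ` is bounded by `C = ∫_{[−λ,λ]} ‖δ‖`
  set C : ℝ := ∫ y in Icc (-lam) lam, ‖δ y‖ with hC
  have hbd : ∀ x : ℝ, ‖δ x‖ ≤ C := by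
    intro x
    rw [h x, norm_mul, norm_neg, hεn, one_mul]
    refine (norm_integral_le_integral_norm _).trans (le_of_eq ?_)
    refine setIntegral_congr_fun measurableSet_Icc fun y _ ↦ ?_
    rw [norm_mul, norm_cexp_two_pi_I, mul_one]
  -- (2) the `L²` class `u` of `g = 𝟙_{[−λ,λ]}·conj δ`
  set g : ℝ → ℂ := (Icc (-lam) lam).indicator fun y ↦ conj (δ y) with hg
  have hδm : AEStronglyMeasurable (fun y ↦ conj (δ y)) (volume.restrict (Icc (-lam) lam)) :=
    Complex.continuous_conj.comp_aestronglyMeasurable hδ.aestronglyMeasurable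
  have hg1 : Integrable g := by
    rw [hg, integrable_indicator_iff measurableSet_Icc]
    refine Integrable.mono' hδ.norm hδm (Eventually.of_forall fun y ↦ ?_)
    rw [RCLike.norm_conj]
  have hg2 : MemLp g 2 (volume : Measure ℝ) := by
    rw [hg, memLp_indicator_iff_restrict measurableSet_Icc]
    refine MemLp.of_bound hδm C (Eventually.of_forall fun y ↦ ?_)
    rw [RCLike.norm_conj]; exact hbd y
  set u : Lp ℂ 2 (volume : Measure ℝ) := hg2.toLp g with hu
  have hu_coe : (u : ℝ → ℂ) =ᵐ[volume] g := hg2.coeFn_toLp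
  have hPu : cutoffProj lam u = u := by
    refine Lp.ext ?_
    filter_upwards [cutoffProj_coeFn lam u, hu_coe] with x e1 e2
    rw [e1, Set.indicator_apply, e2]
    split_ifs with hx
    · rfl
    · rw [hg, Set.indicator_of_notMem hx]
  -- (3) `𝓕u = −ε conj δ` a.e.
  have hFg : ∀ x : ℝ, 𝓕 g x = -ε * conj (δ x) := by
    intro x
    rw [fourier_eq_fourierLaplace]
    have e1 : ∫ v : ℝ, cexp (((-(2 * π * v) : ℝ) : ℂ) * (x : ℂ) * I) * g v =
        ∫ v in Icc (-lam) lam, conj (δ v * cexp (2 * π * I * x * v)) := by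
      rw [← integral_indicator measurableSet_Icc]
      refine integral_congr_ae (Eventually.of_forall fun v ↦ ?_)
      dsimp only
      by_cases hv : v ∈ Icc (-lam) lam
      · rw [Set.indicator_of_mem hv, hg, Set.indicator_of_mem hv, map_mul, conj_cexp_two_pi_I,
          mul_comm]
      · rw [Set.indicator_of_notMem hv, hg, Set.indicator_of_notMem hv, mul_zero]
    rw [e1, integral_conj]
    have e2 : ∫ y in Icc (-lam) lam, δ y * cexp (2 * π * I * x * y) = -ε * δ x := by
      have := congrArg (fun z ↦ -ε * z) (h x)
      rw [← mul_assoc, neg_mul_neg, hε2, one_mul] at this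
      exact this.symm
    rw [e2, map_mul, map_neg, hεc]
  have hFu : ∀ᵐ x : ℝ, (𝓕 u : Lp ℂ 2 (volume : Measure ℝ)) x = -ε * conj (δ x) := by
    filter_upwards [fourier_toLp_ae_eq_fourierIntegral hg1 hg2] with x hx
    rw [hu, hx, hFg]
  -- (4) `P𝓕u = −ε u`, hence `F u = −ε u` and `(1 + εF) u = 0`
  have hPFu : cutoffProj lam (𝓕 u : Lp ℂ 2 (volume : Measure ℝ)) = (-ε) • u := by
    refine Lp.ext ?_
    filter_upwards [cutoffProj_coeFn lam (𝓕 u : Lp ℂ 2 (volume : Measure ℝ)), hFu,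
      Lp.coeFn_smul (-ε) u, hu_coe] with x e1 e2 e3 e4
    rw [e1, e3, Pi.smul_apply, smul_eq_mul, e4, Set.indicator_apply, e2, hg, Set.indicator_apply]
    split_ifs with hx
    · rfl
    · rw [mul_zero]
  have hFu' : slepianF lam u = (-ε) • u := by
    rw [slepianF_apply, hPu, hPFu]
  have hu0 : u = 0 := by
    rcases hε with rfl | rfl
    · -- `(1 + F) u = 0`
      have h1 := (Ring.inverse_mul_cancel _ (isUnit_one_add_slepianF lam))
      have e := congrArg (fun T : Lp ℂ 2 (volume : Measure ℝ) →L[ℂ] Lp ℂ 2 (volume : Measure ℝ) ↦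
        T u) h1
      simp only [mul_apply_eq_comp, add_apply, one_apply_eq_self] at e
      rw [hFu', neg_one_smul, add_neg_cancel, map_zero] at e
      exact e.symm
    · -- `(1 − F) u = 0`
      have h1 := (Ring.inverse_mul_cancel _ (isUnit_one_sub_slepianF lam))
      have e := congrArg (fun T : Lp ℂ 2 (volume : Measure ℝ) →L[ℂ] Lp ℂ 2 (volume : Measure ℝ) ↦
        T u) h1
      simp only [mul_apply_eq_comp, sub_apply, one_apply_eq_self] at e
      rw [hFu', neg_neg, one_smul, sub_self, map_zero] at e
      exact e.symm
  -- (5) `δ = 0` a.e. on `[−λ,λ]`, hence the integral vanishes and `δ ≡ 0`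
  have hg0 : g =ᵐ[volume] 0 := by
    have := hu_coe.symm
    rw [hu0] at this
    exact this.trans (Lp.coeFn_zero ℂ 2 volume)
  have hδ0 : ∀ᵐ y : ℝ, y ∈ Icc (-lam) lam → δ y = 0 := by
    filter_upwards [hg0] with y hy hyI
    rw [hg, Pi.zero_apply, Set.indicator_of_mem hyI] at hy
    simpa using hy
  intro x
  rw [h x]
  have : ∫ y in Icc (-lam) lam, δ y * cexp (2 * π * I * x * y) = ∫ y in Icc (-lam) lam, (0 : ℂ) := by
    refine setIntegral_congr_ae measurableSet_Icc ?_
    filter_upwards [hδ0] with y hy hyI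
    rw [hy hyI, zero_mul]
  rw [this, integral_zero, mul_zero]

/-- `ψ_±` restricted to `ℝ` is integrable on `[−λ,λ]`. [folklore] -/
private theorem integrableOn_Icc_of_differentiable {G : ℂ → ℂ} (hG : Differentiable ℂ G) (lam : ℝ) :
    IntegrableOn (fun y : ℝ ↦ G y) (Icc (-lam) lam) :=
  (hG.continuous.comp Complex.continuous_ofReal).continuousOn.integrableOn_compact isCompact_Icc

/-- **Uniqueness for `+`**: an `L¹([−λ,λ])` solution of `φ(x) + ∫_{[−λ,λ]} φ(y)e^{2πixy}dy = 2cos(2πλx)`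
(all real `x`) is `ψ_+^λ`. [cite: Burnol2002CRAS, Théorème 7 (TeX l.369–375)] -/
theorem eq_psiPlus_of_integral_eq {lam : ℝ} (hlam : 0 < lam) {φ : ℝ → ℂ}
    (hφ : IntegrableOn φ (Icc (-lam) lam))
    (h : ∀ x : ℝ, φ x + ∫ y in Icc (-lam) lam, φ y * cexp (2 * π * I * x * y) =
      2 * Complex.cos (2 * π * lam * x)) (x : ℝ) :
    φ x = psiPlus lam x := by
  have hψ : IntegrableOn (fun y : ℝ ↦ psiPlus lam y) (Icc (-lam) lam) :=
    integrableOn_Icc_of_differentiable (differentiable_psiPlus hlam.le) lam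
  have hδ : IntegrableOn (fun y : ℝ ↦ φ y - psiPlus lam y) (Icc (-lam) lam) := hφ.sub hψ
  have hker : ∀ ξ : ℝ, ContinuousOn (fun y : ℝ ↦ cexp (2 * π * I * ξ * y)) (Icc (-lam) lam) :=
    fun ξ ↦ (by fun_prop : Continuous fun y : ℝ ↦ cexp (2 * π * I * ξ * y)).continuousOn
  have key := eq_zero_of_eq_neg_setIntegral hδ (ε := 1) (Or.inl rfl) (fun ξ ↦ ?_) x
  · exact sub_eq_zero.1 key
  · have e1 := h ξ
    have e2 := psiPlus_add_setIntegral lam ξ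
    have hi1 : IntegrableOn (fun y : ℝ ↦ φ y * cexp (2 * π * I * ξ * y)) (Icc (-lam) lam) :=
      hφ.mul_continuousOn (hker ξ) isCompact_Icc
    have hi2 : IntegrableOn (fun y : ℝ ↦ psiPlus lam y * cexp (2 * π * I * ξ * y)) (Icc (-lam) lam) :=
      hψ.mul_continuousOn (hker ξ) isCompact_Icc
    have e3 : ∫ y in Icc (-lam) lam, (φ y - psiPlus lam y) * cexp (2 * π * I * ξ * y) =
        (∫ y in Icc (-lam) lam, φ y * cexp (2 * π * I * ξ * y)) -
          ∫ y in Icc (-lam) lam, psiPlus lam y * cexp (2 * π * I * ξ * y) := by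
      rw [← integral_sub hi1 hi2]
      refine integral_congr_ae (Eventually.of_forall fun y ↦ ?_)
      simp only [sub_mul]
    rw [e3]
    linear_combination e1 - e2

/-- **Uniqueness for `−`**: an `L¹([−λ,λ])` solution of `φ(x) − ∫_{[−λ,λ]} φ(y)e^{2πixy}dy = 2cos(2πλx)`
is `ψ_−^λ`. [cite: Burnol2002CRAS, Théorème 7 (TeX l.369–375)] -/
theorem eq_psiMinus_of_integral_eq {lam : ℝ} (hlam : 0 < lam) {φ : ℝ → ℂ}
    (hφ : IntegrableOn φ (Icc (-lam) lam))
    (h : ∀ x : ℝ, φ x - ∫ y in Icc (-lam) lam, φ y * cexp (2 * π * I * x * y) =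
      2 * Complex.cos (2 * π * lam * x)) (x : ℝ) :
    φ x = psiMinus lam x := by
  have hψ : IntegrableOn (fun y : ℝ ↦ psiMinus lam y) (Icc (-lam) lam) :=
    integrableOn_Icc_of_differentiable (differentiable_psiMinus hlam.le) lam
  have hδ : IntegrableOn (fun y : ℝ ↦ φ y - psiMinus lam y) (Icc (-lam) lam) := hφ.sub hψ
  have hker : ∀ ξ : ℝ, ContinuousOn (fun y : ℝ ↦ cexp (2 * π * I * ξ * y)) (Icc (-lam) lam) :=
    fun ξ ↦ (by fun_prop : Continuous fun y : ℝ ↦ cexp (2 * π * I * ξ * y)).continuousOn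
  have key := eq_zero_of_eq_neg_setIntegral hδ (ε := -1) (Or.inr rfl) (fun ξ ↦ ?_) x
  · exact sub_eq_zero.1 key
  · have e1 := h ξ
    have e2 := psiMinus_sub_setIntegral lam ξ
    have hi1 : IntegrableOn (fun y : ℝ ↦ φ y * cexp (2 * π * I * ξ * y)) (Icc (-lam) lam) :=
      hφ.mul_continuousOn (hker ξ) isCompact_Icc
    have hi2 : IntegrableOn (fun y : ℝ ↦ psiMinus lam y * cexp (2 * π * I * ξ * y)) (Icc (-lam) lam) :=
      hψ.mul_continuousOn (hker ξ) isCompact_Icc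
    have e3 : ∫ y in Icc (-lam) lam, (φ y - psiMinus lam y) * cexp (2 * π * I * ξ * y) =
        (∫ y in Icc (-lam) lam, φ y * cexp (2 * π * I * ξ * y)) -
          ∫ y in Icc (-lam) lam, psiMinus lam y * cexp (2 * π * I * ξ * y) := by
      rw [← integral_sub hi1 hi2]
      refine integral_congr_ae (Eventually.of_forall fun y ↦ ?_)
      simp only [sub_mul]
    rw [e3]
    linear_combination e1 - e2

/-! ## D. `A_λ = ψ_+ + 𝓕ψ_+` and `−iB_λ = −ψ_− + 𝓕ψ_−` as tempered distributions -/

/-- `φ·v` is integrable for `φ ∈ 𝓢`, `v ∈ L²`. [folklore] -/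
private theorem integrable_schwartz_mul_Lp (φ : 𝓢(ℝ, ℂ)) (v : Lp ℂ 2 (volume : Measure ℝ)) :
    Integrable (fun t : ℝ ↦ φ t * v t) :=
  (φ.memLp 2 (volume : Measure ℝ)).integrable_mul (Lp.memLp v)

/-- `g·φ` is integrable for `φ ∈ 𝓢`, `g ∈ L²`, written with `g` on the left. [folklore] -/
private theorem integrable_Lp_mul_schwartz (v : Lp ℂ 2 (volume : Measure ℝ)) (φ : 𝓢(ℝ, ℂ)) :
    Integrable (fun t : ℝ ↦ v t * φ t) :=
  (Lp.memLp v).integrable_mul (φ.memLp 2 (volume : Measure ℝ))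

/-- `2cos(2πλt)·g` is integrable for `g` integrable. [folklore] -/
private theorem integrable_twoCos_mul (lam : ℝ) {g : ℝ → ℂ} (hg : Integrable g) :
    Integrable (fun t : ℝ ↦ (2 * Complex.cos (2 * π * lam * (t : ℂ))) * g t) := by
  have hc : Continuous fun t : ℝ ↦ 2 * Complex.cos (2 * π * lam * (t : ℂ)) := by fun_prop
  refine hg.bdd_mul (c := 2) hc.aestronglyMeasurable (Eventually.of_forall fun t ↦ ?_)
  rw [← twoCos_eq]
  exact norm_twoCos_le lam t

/-- `∫ (2cos 2πλt)·g(t) dt = ∫ g(t)·(𝐞(λt) + 𝐞(−λt)) dt`. [folklore] -/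
private theorem integral_twoCos_mul (lam : ℝ) (g : ℝ → ℂ) :
    ∫ t : ℝ, 2 * Complex.cos (2 * π * lam * (t : ℂ)) * g t =
      ∫ t : ℝ, g t * (((𝐞 (lam * t) : Circle) : ℂ) + ((𝐞 (-(lam * t)) : Circle) : ℂ)) := by
  refine integral_congr_ae (Eventually.of_forall fun t ↦ ?_)
  dsimp only
  rw [twoChar_eq_twoCos, twoCos_eq, mul_comm]

/-- **`∫ ψ_+ φ = ∫ φ·2cos(2πλ·) − ∫ φ·𝓕h_+`** for `φ ∈ 𝓢`. [cite: Burnol2002CRAS, Théorème 7 (TeX l.369–375)] -/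
theorem integral_psiPlus_mul (lam : ℝ) (φ : 𝓢(ℝ, ℂ)) :
    ∫ t : ℝ, psiPlus lam t * φ t =
      (∫ t : ℝ, φ t * (((𝐞 (lam * t) : Circle) : ℂ) + ((𝐞 (-(lam * t)) : Circle) : ℂ))) -
        ∫ t : ℝ, φ t * (𝓕 (hPlus lam) : Lp ℂ 2 (volume : Measure ℝ)) t := by
  have h1 : ∫ t : ℝ, psiPlus lam t * φ t =
      ∫ t : ℝ, (2 * Complex.cos (2 * π * lam * (t : ℂ))) * φ t -
        (𝓕 (hPlus lam) : Lp ℂ 2 (volume : Measure ℝ)) t * φ t := by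
    refine integral_congr_ae ?_
    filter_upwards [fourier_coeFn_ae_eq_setIntegral (cutoffProj_hPlus lam) (compNeg_hPlus lam)]
      with t ht
    unfold psiPlus
    rw [ht, sub_mul]
  rw [h1, integral_sub (integrable_twoCos_mul lam φ.integrable)
    (integrable_Lp_mul_schwartz _ φ), integral_twoCos_mul]
  congr 1
  exact integral_congr_ae (Eventually.of_forall fun t ↦ mul_comm _ _)

/-- **`∫ ψ_− φ = ∫ φ·2cos(2πλ·) + ∫ φ·𝓕h_−`** for `φ ∈ 𝓢`. [cite: Burnol2002CRAS, Théorème 7 (TeX l.369–375)] -/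
theorem integral_psiMinus_mul (lam : ℝ) (φ : 𝓢(ℝ, ℂ)) :
    ∫ t : ℝ, psiMinus lam t * φ t =
      (∫ t : ℝ, φ t * (((𝐞 (lam * t) : Circle) : ℂ) + ((𝐞 (-(lam * t)) : Circle) : ℂ))) +
        ∫ t : ℝ, φ t * (𝓕 (hMinus lam) : Lp ℂ 2 (volume : Measure ℝ)) t := by
  have h1 : ∫ t : ℝ, psiMinus lam t * φ t =
      ∫ t : ℝ, (2 * Complex.cos (2 * π * lam * (t : ℂ))) * φ t +
        (𝓕 (hMinus lam) : Lp ℂ 2 (volume : Measure ℝ)) t * φ t := by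
    refine integral_congr_ae ?_
    filter_upwards [fourier_coeFn_ae_eq_setIntegral (cutoffProj_hMinus lam) (compNeg_hMinus lam)]
      with t ht
    unfold psiMinus
    rw [ht, add_mul]
  rw [h1, integral_add (integrable_twoCos_mul lam φ.integrable)
    (integrable_Lp_mul_schwartz _ φ), integral_twoCos_mul]
  congr 1
  exact integral_congr_ae (Eventually.of_forall fun t ↦ mul_comm _ _)

/-- `∫ φ·(h + 𝓕h) = ∫ φ·h + ∫ φ·𝓕h`. [folklore] -/
private theorem integral_mul_add_fourier (φ : 𝓢(ℝ, ℂ)) (v : Lp ℂ 2 (volume : Measure ℝ)) :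
    ∫ t : ℝ, φ t * ((v + fourierL2 v : Lp ℂ 2 (volume : Measure ℝ)) : ℝ → ℂ) t =
      (∫ t : ℝ, φ t * v t) + ∫ t : ℝ, φ t * (𝓕 v : Lp ℂ 2 (volume : Measure ℝ)) t := by
  rw [← integral_add (integrable_schwartz_mul_Lp φ v) (integrable_schwartz_mul_Lp φ _)]
  refine integral_congr_ae ?_
  filter_upwards [Lp.coeFn_add v (fourierL2 v)] with t ht
  rw [ht, Pi.add_apply, fourierL2_apply, mul_add]

/-- `∫ φ·(h − 𝓕h) = ∫ φ·h − ∫ φ·𝓕h`. [folklore] -/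
private theorem integral_mul_sub_fourier (φ : 𝓢(ℝ, ℂ)) (v : Lp ℂ 2 (volume : Measure ℝ)) :
    ∫ t : ℝ, φ t * ((v - fourierL2 v : Lp ℂ 2 (volume : Measure ℝ)) : ℝ → ℂ) t =
      (∫ t : ℝ, φ t * v t) - ∫ t : ℝ, φ t * (𝓕 v : Lp ℂ 2 (volume : Measure ℝ)) t := by
  rw [← integral_sub (integrable_schwartz_mul_Lp φ v) (integrable_schwartz_mul_Lp φ _)]
  refine integral_congr_ae ?_
  filter_upwards [Lp.coeFn_sub v (fourierL2 v)] with t ht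
  rw [ht, Pi.sub_apply, fourierL2_apply, mul_sub]

/-- **`A_λ = ψ_+ + 𝓕ψ_+`**: `A_λ(φ) = ∫ ψ_+ φ + ∫ ψ_+ 𝓕φ` for `φ ∈ 𝓢`.
[cite: Burnol2002CRAS, Théorème 7 (TeX l.369–375)] -/
theorem distA_eq_psiPlus (lam : ℝ) (φ : 𝓢(ℝ, ℂ)) :
    distA lam φ = (∫ t : ℝ, psiPlus lam t * φ t) + ∫ t : ℝ, psiPlus lam t * (𝓕 φ : 𝓢(ℝ, ℂ)) t := by
  rw [distA_apply, integral_psiPlus_mul, integral_psiPlus_mul, integral_fourier_mul_twoChar,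
    integral_fourier_schwartz_mul_fourier φ (compNeg_hPlus lam), integral_mul_add_fourier]
  ring

/-- **`−iB_λ = −ψ_− + 𝓕ψ_−`**: `−iB_λ(φ) = −∫ ψ_− φ + ∫ ψ_− 𝓕φ` for `φ ∈ 𝓢`.
[cite: Burnol2002CRAS, Théorème 7 (TeX l.369–375)] -/
theorem distNegIB_eq_psiMinus (lam : ℝ) (φ : 𝓢(ℝ, ℂ)) :
    distNegIB lam φ =
      -(∫ t : ℝ, psiMinus lam t * φ t) + ∫ t : ℝ, psiMinus lam t * (𝓕 φ : 𝓢(ℝ, ℂ)) t := by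
  rw [distNegIB_apply, integral_psiMinus_mul, integral_psiMinus_mul, integral_fourier_mul_twoChar,
    integral_fourier_schwartz_mul_fourier φ (compNeg_hMinus lam), integral_mul_sub_fourier]
  ring

/-! ## Théorème 7 -/

/-- **Théorème 7 (Burnol 2002) holds.** `ψ_±^λ` is entire and even; it is the unique entire function
a.e. equal to `h_± = (1 ± F_λ)^{-1}(2cos 2πλy)` on `(−λ,λ)`; it is the unique solution, integrable on
`[−λ,λ]`, of `φ(x) ± ∫_{[−λ,λ]} φ(y)e^{2πixy}dy = 2cos(2πλx)`; and `A_λ = ψ_+ + 𝓕ψ_+`,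
`−iB_λ = −ψ_− + 𝓕ψ_−` as tempered distributions. Discharges the named fact `Burnol2002CRAS_thm7`.
[cite: Burnol2002CRAS, Théorème 7 (TeX l.369–375)] -/
theorem Burnol2002CRAS_thm7_holds : Burnol2002CRAS_thm7 := by
  intro lam hlam
  refine ⟨⟨differentiable_psiPlus hlam.le, differentiable_psiMinus hlam.le, psiPlus_neg lam,
      psiMinus_neg lam⟩, ⟨?_, ?_, fun G hG h ↦ eq_psiPlus_of_ae_eq hlam hG h,
      fun G hG h ↦ eq_psiMinus_of_ae_eq hlam hG h⟩,
    ⟨psiPlus_add_setIntegral lam, psiMinus_sub_setIntegral lam,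
      fun φ hφ h ↦ eq_psiPlus_of_integral_eq hlam hφ h,
      fun φ hφ h ↦ eq_psiMinus_of_integral_eq hlam hφ h⟩,
    ⟨distA_eq_psiPlus lam, distNegIB_eq_psiMinus lam⟩⟩
  · filter_upwards [psiPlus_eq_hPlus_ae lam] with x hx hxI
    exact hx (Ioo_subset_Icc_self hxI)
  · filter_upwards [psiMinus_eq_hMinus_ae lam] with x hx hxI
    exact hx (Ioo_subset_Icc_self hxI)

end Burnol2002

end Literature.Analysis.DeBrangesSpaces
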